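/-
Copyright: public-domain mathematics; typed transcription for the H21 Literature library (cell pub-balaban, PAPER SUB-CELL B05 gen 2).

# Bałaban, *Propagators and renormalization transformations for lattice gauge theories. I*,
# Commun. Math. Phys. **95** (1984) 17–40 — Proposition 1.1: the elementary momentum-space leaves behind (1.85)–(1.86)

[cite: Balaban1984PropagatorsI]  T. Bałaban, Commun. Math. Phys. 95 (1984) 17–40 (= B5 of the series), pp. 31–33.

WHAT THIS MODULE IS.  Proposition 1.1 of B5 ((1.89)–(1.90), p. 33; typed verbatim as `B5.Prop11Printed`) asserts that the
propagator `G = Δ_a⁻¹` and its derivatives up to second order are bounded on `L²(T_η)` uniformly in `k`.  The printed proof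
(pp. 31–33) writes `G` in momentum representation (1.83) and rests on two displayed scalar facts about the functions

  (1.84)  `φ_μ(p′) = 1 + a Σ_{l″} |u(p′+l″)|² |v_μ(p′+l″)|² / Δ(p′+l″)`   for `p′ ≠ 0`,

namely (p. 32, verbatim): "Let us notice at first that the function
  (1.85)  `Δ₀(p′)φ_μ(p′) = Δ₀(p′) + a Σ_{l″} |u(p′+l″)|² |v_μ(p′+l″)|² Δ₀(p′) / Δ(p′+l″)`
has a limit as `p′ → 0`, `lim_{p′→0} Δ₀(p′)φ_μ(p′) = a`, and it is bounded from below and above by positve [sic] constants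
independent of `k` and depending on `d` and `a` only. From this it follows that the function
  (1.86)  `Σ_λ |∂_{1,λ}(p′)|² / (Δ₀²(p′) φ_λ(p′))`
has the same property, hence also its inverse."

No constants and no derivation are printed.  The audit census `HOME/b2b-balaban-b05-g2/Prop11-census.md` (GAPS C-B5-4b)
supplies them from four elementary trigonometric inequalities E1–E4.  THIS FILE KERNEL-CHECKS, in the momentum vocabulary
of `B4Strip` (b04-g2: `S1r`, `Sxir`, `uFactorr`, `Ur`, `DeltaXir`, `Delta1r`, `shiftr`; dictionary below),

* the one-variable leaves:  `abs_sin_nat_mul_le` (`|sin nθ| ≤ n|sin θ|`) ⇒ `S1r_le_Sxir_shift` (`|∂_{1,μ}(p′)|² ≤ |∂_μ(p′+l)|²`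
  for every `l`, i.e. E3: `|v_μ(p′+l)|² ≤ 1`, `uFactorr_le_one`, `Ur_le_one`: `|u(p′+l)|² ≤ 1`), `Delta1r_le_DeltaXir_shift`
  (`Δ₀(p′) ≤ Δ(p′+l)`), E2: `DeltaXir_le_Delta1r` (`Δ(p′) ≤ (π²/4) Δ₀(p′)` on the Brillouin zone), `Delta1r_le` (`Δ₀ ≤ 4d`),
  E1: `Sxir_shift_ge_four` / `DeltaXir_shift_ge_four` (`Δ(p′+l) ≥ 4` for `l ≠ 0`, `|p′_μ| ≤ π`);
* the objects (1.84) `phiMu` and (1.86) `q186`, and the bounds with explicit constants: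
  `ineq185_lower`:  `a (4/π²)^{d+2} ≤ Δ₀(p′)φ_μ(p′)`  on the punctured Brillouin zone (every `n = L^k ≥ 1`, `a ≥ 0`);
  `ineq185_upper`:  `Δ₀(p′)φ_μ(p′) ≤ 4d + a + a·d·S₀`  for any `S₀ ≥ Σ_{l≠0} |u(p′+l)|²`;
  `ineq186`: `γ₊⁻¹ ≤ (1.86) ≤ γ₋⁻¹` from `γ₋ ≤ Δ₀φ_λ ≤ γ₊` (the printed "has the same property, hence also its inverse",
  as a convex-combination sandwich), and `ineq186_explicit` combining the three;
* E4 of the census, KERNEL (section `E4`): `sum_Ur_eq_one` — `Σ_l |u(p′+l)|² = 1` on the Brillouin zone for every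
  `n = L^k ≥ 1` (in operator language `Q_kQ_k* = I` read in momentum space; classically `Σ_{m mod N} csc²(x + mπ/N) =
  N² csc²(Nx)`), proved via the Dirichlet-kernel modulus `|v_μ|²(x; j) = n⁻²|Σ_{r<n} e^{ir(x+2πj)/n}|²`
  (`uFactorr_eq_normSq`) and orthogonality of the characters of `ℤ/n` (`sum_rootOfUnity_pow`, `sum_normSq_geom_sum`);
  hence `S0_le_one`, the leaf-free `ineq185_upper'` (`Δ₀φ_μ ≤ 4d + a + a·d`) and `ineq185_186`: (1.85)–(1.86) with the
  constants `γ₋ = a(4/π²)^{d+2}`, `γ₊ = 4d + a + a·d`, all kernel-checked.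

DICTIONARY (B5 ↔ `B4Strip`, real momenta; `n = L^k = η⁻¹`, `l = 2πk`, `k ∈ {0,…,n−1}^d` = `Fin d → Fin n`):
`|∂_{1,μ}(p′)|² = S1r (p′_μ)`, `Δ₀(p′) = Delta1r 0 p′`; `|∂_μ(p′+l)|² = Sxir n (p′_μ + 2πk_μ)`, `Δ(p′+l) = DeltaXir n 0 (shiftr n k p′)`;
`|v_μ(p′+l)|² = |∂_{1,μ}(p′)|²/|∂_μ(p′+l)|² = uFactorr n k_μ p′_μ` (value `1` at the removable point `k_μ = 0, p′_μ = 0`, as in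
B5 (1.30)–(1.31) "by continuity"); `|u(p′+l)|² = Π_μ |v_μ(p′+l)|² = Ur n k p′` (B5 (1.31) `u = Π_μ v_μ`).

WHAT IS NOT HERE (markdown only, Prop11-census.md §§3–5 + kit job j039558): the operator-norm
bookkeeping of the three groups of terms of (1.83) ((1.87)–(1.88): block estimates, the two `l′ = l` cancellations) that turns
(1.85)–(1.86) + E1–E4 into the bound (1.89) with `γ₀⁻¹(d,a)` explicit; (1.89) ⇒ (1.90).  Nothing in this file is progress on a
summit; value = kernel-checked elementary leaves of a located, audit-supplied step of a published proof.
-/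
import Mathlib
import Literature.MathematicalPhysics.QuantumFieldTheory.Balaban1983to89.B4Strip

namespace Literature.MathematicalPhysics.QuantumFieldTheory.Balaban1983to89.B5Prop11Leaves

open Finset
open Literature.MathematicalPhysics.QuantumFieldTheory.Balaban1983to89.B4Strip

noncomputable section

/-! ### One-variable leaves -/

/-- `|sin(nθ)| ≤ n |sin θ|` for every natural `n`. [folklore] -/
theorem abs_sin_nat_mul_le (n : ℕ) (θ : ℝ) : |Real.sin (n * θ)| ≤ n * |Real.sin θ| := by
  induction n with
  | zero => simp
  | succ n ih =>
    have h1 : Real.sin (((n + 1 : ℕ) : ℝ) * θ)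
        = Real.sin (n * θ) * Real.cos θ + Real.cos (n * θ) * Real.sin θ := by
      rw [show (((n + 1 : ℕ) : ℝ)) * θ = n * θ + θ by push_cast; ring, Real.sin_add]
    rw [h1]
    have hc1 := Real.abs_cos_le_one θ
    have hc2 := Real.abs_cos_le_one (n * θ)
    have hs0 := abs_nonneg (Real.sin θ)
    have hs1 := abs_nonneg (Real.sin (n * θ))
    calc |Real.sin (n * θ) * Real.cos θ + Real.cos (n * θ) * Real.sin θ|
        ≤ |Real.sin (n * θ) * Real.cos θ| + |Real.cos (n * θ) * Real.sin θ| := abs_add_le _ _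
      _ = |Real.sin (n * θ)| * |Real.cos θ| + |Real.cos (n * θ)| * |Real.sin θ| := by rw [abs_mul, abs_mul]
      _ ≤ |Real.sin (n * θ)| * 1 + 1 * |Real.sin θ| := by gcongr
      _ ≤ n * |Real.sin θ| * 1 + 1 * |Real.sin θ| := by gcongr
      _ = ((n + 1 : ℕ) : ℝ) * |Real.sin θ| := by push_cast; ring

/-- E3 / E2-lower of the census: `|∂_{1,μ}(p′)|² ≤ |∂_μ(p′ + l)|²` for EVERY `l_μ = 2πk`, i.e. `|v_μ(p′+l)|² ≤ 1`
(`S₁(x) = 4 sin²(x/2) = 4 sin²(n·θ) ≤ 4n² sin² θ = S_ξ(x + 2πk)`, `θ = (x+2πk)/2n`). [folklore] -/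
theorem S1r_le_Sxir_shift (n : ℕ) (hn : 1 ≤ n) (x : ℝ) (k : ℕ) :
    S1r x ≤ Sxir n (x + 2 * Real.pi * k) := by
  rw [S1r_eq, Sxir_eq]
  have hn0 : (n : ℝ) ≠ 0 := by exact_mod_cast (show n ≠ 0 by omega)
  set θ := (x + 2 * Real.pi * k) / (2 * n) with hθ
  have hnθ : (n : ℝ) * θ = x / 2 + k * Real.pi := by rw [hθ]; field_simp
  have h1 : Real.sin (x / 2) ^ 2 = Real.sin (n * θ) ^ 2 := by
    rw [hnθ, Real.sin_add_nat_mul_pi]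
    have : ((-1 : ℝ) ^ k) ^ 2 = 1 := by rw [← pow_mul, mul_comm, pow_mul, neg_one_sq, one_pow]
    simp only [mul_pow, this, one_mul]
  have h2 : |Real.sin (n * θ)| ^ 2 ≤ (n * |Real.sin θ|) ^ 2 := by
    have := abs_sin_nat_mul_le n θ
    gcongr
  rw [sq_abs] at h2
  calc 4 * Real.sin (x / 2) ^ 2 = 4 * Real.sin (n * θ) ^ 2 := by rw [h1]
    _ ≤ 4 * (n * |Real.sin θ|) ^ 2 := by linarith
    _ = 4 * (n : ℝ) ^ 2 * Real.sin θ ^ 2 := by rw [mul_pow, sq_abs]; ring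

/-- `|∂_{1,μ}(p′)|² ≤ |∂_μ(p′)|²` (the case `l = 0`). [folklore] -/
theorem S1r_le_Sxir (n : ℕ) (hn : 1 ≤ n) (x : ℝ) : S1r x ≤ Sxir n x := by
  simpa using S1r_le_Sxir_shift n hn x 0

/-- E3: `|v_μ(p′+l)|² ≤ 1` for every `l`. [folklore] -/
theorem uFactorr_le_one (n : ℕ) (hn : 1 ≤ n) (k : ℕ) (x : ℝ) : uFactorr n k x ≤ 1 := by
  unfold uFactorr
  split_ifs with hk hx
  · exact le_rfl
  · have h := S1r_le_Sxir n hn x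
    rcases (Sxir_nonneg n x).eq_or_lt with h0 | hpos
    · rw [← h0, div_zero]; exact zero_le_one
    · rw [div_le_iff₀ hpos, one_mul]; exact h
  · have h := S1r_le_Sxir_shift n hn x k
    rcases (Sxir_nonneg n (x + 2 * Real.pi * k)).eq_or_lt with h0 | hpos
    · rw [← h0, div_zero]; exact zero_le_one
    · rw [div_le_iff₀ hpos, one_mul]; exact h

variable {d : ℕ}

/-- E3: `|u(p′+l)|² ≤ 1` for every `l`. [folklore] -/
theorem Ur_le_one (n : ℕ) (hn : 1 ≤ n) (k : Fin d → Fin n) (s : Fin d → ℝ) : Ur n k s ≤ 1 :=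
  Finset.prod_le_one (fun _ _ => uFactorr_nonneg _ _ _) (fun _ _ => uFactorr_le_one n hn _ _)

/-- `Δ₀(p′) ≤ Δ(p′ + l)` for every `l` (sum of `S1r_le_Sxir_shift`). [folklore] -/
theorem Delta1r_le_DeltaXir_shift (n : ℕ) (hn : 1 ≤ n) (k : Fin d → Fin n) (s : Fin d → ℝ) :
    Delta1r 0 s ≤ DeltaXir n 0 (shiftr n k s) := by
  unfold Delta1r DeltaXir shiftr
  simp only [add_zero]
  exact Finset.sum_le_sum (fun μ _ => S1r_le_Sxir_shift n hn (s μ) (k μ : ℕ))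

/-- `Δ₀(p′) ≤ Δ(p′)`. [folklore] -/
theorem Delta1r_le_DeltaXir (n : ℕ) (hn : 1 ≤ n) (s : Fin d → ℝ) : Delta1r 0 s ≤ DeltaXir n 0 s := by
  unfold Delta1r DeltaXir
  simp only [add_zero]
  exact Finset.sum_le_sum (fun μ _ => S1r_le_Sxir n hn (s μ))

/-- E2: `|∂_μ(p′)|² ≤ p′_μ² ≤ (π²/4)|∂_{1,μ}(p′)|²` on `|p′_μ| ≤ π`. [folklore] -/
theorem Sxir_le_S1r (n : ℕ) (x : ℝ) (hx : |x| ≤ Real.pi) : Sxir n x ≤ Real.pi ^ 2 / 4 * S1r x := by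
  have h1 := Sxir_le n x
  have h2 := S1r_ge x hx
  have hpi := Real.pi_pos
  have h3 : x ^ 2 ≤ Real.pi ^ 2 / 4 * S1r x := by
    rw [div_le_iff₀ (by positivity)] at h2
    nlinarith
  linarith

/-- E2 summed: `Δ(p′) ≤ (π²/4) Δ₀(p′)` on the Brillouin zone. [folklore] -/
theorem DeltaXir_le_Delta1r (n : ℕ) (s : Fin d → ℝ) (hs : ∀ μ, |s μ| ≤ Real.pi) :
    DeltaXir n 0 s ≤ Real.pi ^ 2 / 4 * Delta1r 0 s := by
  unfold DeltaXir Delta1r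
  simp only [add_zero]
  rw [Finset.mul_sum]
  exact Finset.sum_le_sum (fun μ _ => Sxir_le_S1r n (s μ) (hs μ))

/-- `|∂_{1,μ}|² = 2 − 2cos ≤ 4`. [folklore] -/
theorem S1r_le_four (x : ℝ) : S1r x ≤ 4 := by
  unfold S1r
  have := Real.neg_one_le_cos x
  linarith

/-- `Δ₀(p′) ≤ 4d`. [folklore] -/
theorem Delta1r_le (s : Fin d → ℝ) : Delta1r 0 s ≤ 4 * d := by
  unfold Delta1r
  simp only [add_zero]
  calc ∑ μ, S1r (s μ) ≤ ∑ _μ : Fin d, (4 : ℝ) := Finset.sum_le_sum (fun μ _ => S1r_le_four (s μ))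
    _ = 4 * d := by simp [mul_comm]

/-- E1: `|∂_μ(p′ + l)|² ≥ 4` whenever `l_μ = 2πk`, `1 ≤ k ≤ n − 1`, `|p′_μ| ≤ π`
(then `θ = (p′_μ + 2πk)/2n ∈ [π/2n, π − π/2n]`, so `sin θ ≥ sin(π/2n) ≥ 1/n` by Jordan's inequality). [folklore] -/
theorem Sxir_shift_ge_four (n k : ℕ) (hk1 : 1 ≤ k) (hk2 : k + 1 ≤ n) (x : ℝ) (hx : |x| ≤ Real.pi) :
    4 ≤ Sxir n (x + 2 * Real.pi * k) := by
  rw [Sxir_eq]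
  have hpi := Real.pi_pos
  have hk1' : (1 : ℝ) ≤ k := by exact_mod_cast hk1
  have hk2' : (k : ℝ) + 1 ≤ n := by exact_mod_cast hk2
  have hn0 : (0 : ℝ) < n := by linarith
  obtain ⟨hx1, hx2⟩ := abs_le.mp hx
  set θ := (x + 2 * Real.pi * k) / (2 * n) with hθ
  have hθ1 : Real.pi / (2 * n) ≤ θ := by
    rw [hθ, div_le_div_iff_of_pos_right (by positivity)]
    nlinarith
  have hθ2 : θ ≤ Real.pi - Real.pi / (2 * n) := by
    have e1 : θ + Real.pi / (2 * n) = (x + 2 * Real.pi * k + Real.pi) / (2 * n) := by rw [hθ]; ring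
    have e2 : (x + 2 * Real.pi * k + Real.pi) / (2 * n) ≤ Real.pi := by
      rw [div_le_iff₀ (by positivity)]; nlinarith
    linarith
  have key : ∀ ψ : ℝ, Real.pi / (2 * n) ≤ ψ → ψ ≤ Real.pi / 2 → 1 / (n : ℝ) ≤ Real.sin ψ := by
    intro ψ hψ1 hψ2
    have h0 : 0 ≤ ψ := le_trans (by positivity) hψ1
    have hj := Real.mul_le_sin h0 hψ2
    calc 1 / (n : ℝ) = 2 / Real.pi * (Real.pi / (2 * n)) := by field_simp
      _ ≤ 2 / Real.pi * ψ := by gcongr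
      _ ≤ Real.sin ψ := hj
  have hsin : 1 / (n : ℝ) ≤ Real.sin θ := by
    rcases le_total θ (Real.pi / 2) with h | h
    · exact key θ hθ1 h
    · rw [← Real.sin_pi_sub]
      exact key _ (by linarith) (by linarith)
  have h0 : 0 ≤ 1 / (n : ℝ) := by positivity
  have hsq : (1 / (n : ℝ)) ^ 2 ≤ Real.sin θ ^ 2 := by gcongr
  calc (4 : ℝ) = 4 * (n : ℝ) ^ 2 * (1 / (n : ℝ)) ^ 2 := by field_simp
    _ ≤ 4 * (n : ℝ) ^ 2 * Real.sin θ ^ 2 := by gcongr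

/-- E1 summed: `Δ(p′ + l) ≥ 4` for `l ≠ 0` on the Brillouin zone (`Λ ∖ {0}` carries no small denominators). [folklore] -/
theorem DeltaXir_shift_ge_four (n : ℕ) [NeZero n] (k : Fin d → Fin n) (hk : k ≠ fun _ => 0)
    (s : Fin d → ℝ) (hs : ∀ μ, |s μ| ≤ Real.pi) : 4 ≤ DeltaXir n 0 (shiftr n k s) := by
  obtain ⟨μ, hμ⟩ : ∃ μ, k μ ≠ 0 := Function.ne_iff.mp hk
  have hk1 : 1 ≤ (k μ : ℕ) := Nat.one_le_iff_ne_zero.mpr (fun h => hμ (Fin.ext h))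
  have hk2 : (k μ : ℕ) + 1 ≤ n := (k μ).isLt
  have h1 := Sxir_shift_ge_four n (k μ : ℕ) hk1 hk2 (s μ) (hs μ)
  unfold DeltaXir shiftr
  simp only [add_zero]
  have h2 : Sxir n (s μ + 2 * Real.pi * ((k μ : ℕ) : ℝ)) ≤ ∑ ν, Sxir n (s ν + 2 * Real.pi * ((k ν : ℕ) : ℝ)) :=
    Finset.single_le_sum (f := fun ν => Sxir n (s ν + 2 * Real.pi * ((k ν : ℕ) : ℝ)))
      (fun ν _ => Sxir_nonneg n _) (Finset.mem_univ μ)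
  linarith

/-- `Δ(p′) > 0` on the punctured Brillouin zone. [folklore] -/
theorem DeltaXir_pos (n : ℕ) (hn : 1 ≤ n) (s : Fin d → ℝ) (hs : ∀ μ, |s μ| ≤ Real.pi)
    (μ : Fin d) (hμ : s μ ≠ 0) : 0 < DeltaXir n 0 s := by
  have h1 : 0 < Sxir n (s μ) := Sxir_pos n hn (s μ) hμ (hs μ)
  have h2 : Sxir n (s μ) ≤ ∑ ν, Sxir n (s ν) :=
    Finset.single_le_sum (fun ν _ => Sxir_nonneg n (s ν)) (Finset.mem_univ μ)
  unfold DeltaXir; linarith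

/-- `Δ₀(p′) > 0` on the punctured Brillouin zone. [folklore] -/
theorem Delta1r_pos (s : Fin d → ℝ) (hs : ∀ μ, |s μ| ≤ Real.pi) (μ : Fin d) (hμ : s μ ≠ 0) :
    0 < Delta1r 0 s := by
  have h0 : 0 < (s μ) ^ 2 := lt_of_le_of_ne (sq_nonneg _) (Ne.symm (pow_ne_zero 2 hμ))
  have h1 : 0 < S1r (s μ) := by
    have h4 := S1r_ge (s μ) (hs μ)
    have h5 : 0 < 4 * (s μ) ^ 2 / Real.pi ^ 2 := by positivity
    linarith
  have h2 : S1r (s μ) ≤ ∑ ν, S1r (s ν) :=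
    Finset.single_le_sum (fun ν _ => S1r_nonneg (s ν)) (Finset.mem_univ μ)
  unfold Delta1r; linarith

/-- `shiftr` by `l = 0` is the identity. [folklore] -/
theorem shiftr_zero (n : ℕ) [NeZero n] (s : Fin d → ℝ) : shiftr n (fun _ => (0 : Fin n)) s = s := by
  funext μ; simp [shiftr]

/-! ### (1.84)–(1.86) -/

/-- (1.84) verbatim: "`φ_μ(p′) = 1 + a Σ_{l″} |u(p′+l″)|² |v_μ(p′+l″)|² / Δ(p′+l″)`  for `p′ ≠ 0`."
Here for real `p′ = s`, `l″ = 2πk`, `k : Fin d → Fin n` (the formula makes sense for every `s`; the paper needs `p′ ≠ 0`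
only for the surrounding (1.83)). [cite: Balaban1984PropagatorsI, (1.84) p.31] -/
def phiMu (n : ℕ) [NeZero n] (a : ℝ) (μ : Fin d) (s : Fin d → ℝ) : ℝ :=
  1 + a * ∑ k : Fin d → Fin n, Ur n k s * uFactorr n (k μ : ℕ) (s μ) / DeltaXir n 0 (shiftr n k s)

/-- the function (1.86) verbatim: "`Σ_λ |∂_{1,λ}(p′)|² / (Δ₀²(p′) φ_λ(p′))`". [cite: Balaban1984PropagatorsI, (1.86) p.32] -/
def q186 (n : ℕ) [NeZero n] (a : ℝ) (s : Fin d → ℝ) : ℝ :=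
  ∑ μ : Fin d, S1r (s μ) / (Delta1r 0 s ^ 2 * phiMu n a μ s)

/-- the summand of (1.84) is non-negative. [folklore] -/
theorem phiMu_term_nonneg (n : ℕ) [NeZero n] (μ : Fin d) (s : Fin d → ℝ) (k : Fin d → Fin n) :
    0 ≤ Ur n k s * uFactorr n (k μ : ℕ) (s μ) / DeltaXir n 0 (shiftr n k s) :=
  div_nonneg (mul_nonneg (Ur_nonneg _ _ _) (uFactorr_nonneg _ _ _)) (DeltaXir_nonneg n 0 le_rfl _)

/-- `φ_μ ≥ 1` for `a ≥ 0`. [folklore] -/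
theorem one_le_phiMu (n : ℕ) [NeZero n] (a : ℝ) (ha : 0 ≤ a) (μ : Fin d) (s : Fin d → ℝ) :
    1 ≤ phiMu n a μ s := by
  unfold phiMu
  have : 0 ≤ ∑ k : Fin d → Fin n, Ur n k s * uFactorr n (k μ : ℕ) (s μ) / DeltaXir n 0 (shiftr n k s) :=
    Finset.sum_nonneg (fun k _ => phiMu_term_nonneg n μ s k)
  nlinarith

/-- (1.85), LOWER BOUND with an explicit constant (census §2: keep only the `l″ = 0` term,
`Δ₀φ_μ ≥ a |u(p′)|² |v_μ(p′)|² Δ₀(p′)/Δ(p′) ≥ a (4/π²)^d (4/π²) (4/π²)`): on the punctured Brillouin zone, for every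
`n = L^k ≥ 1` and `a ≥ 0`,  `a (4/π²)^{d+2} ≤ Δ₀(p′) φ_μ(p′)` — "bounded from below … by positve [sic] constants independent
of `k` and depending on `d` and `a` only". [cite: Balaban1984PropagatorsI, (1.85) p.32] -/
theorem ineq185_lower (n : ℕ) [NeZero n] (hn : 1 ≤ n) (a : ℝ) (ha : 0 ≤ a) (μ : Fin d) (s : Fin d → ℝ)
    (hs : ∀ ν, |s ν| ≤ Real.pi) (ν₀ : Fin d) (hν₀ : s ν₀ ≠ 0) :
    a * (4 / Real.pi ^ 2) ^ (d + 2) ≤ Delta1r 0 s * phiMu n a μ s := by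
  have hD : 0 < DeltaXir n 0 s := DeltaXir_pos n hn s hs ν₀ hν₀
  have hΔ0 : 0 ≤ Delta1r 0 s := Delta1r_nonneg 0 le_rfl s
  have h1 : (4 / Real.pi ^ 2) ^ d ≤ Ur n (fun _ => (0 : Fin n)) s := Ur_zero_ge n hn s hs
  have h2 : 4 / Real.pi ^ 2 ≤ uFactorr n ((fun _ => (0 : Fin n)) μ : ℕ) (s μ) := by
    simpa using uFactorr_zero_ge n hn (s μ) (hs μ)
  have h3 : 4 / Real.pi ^ 2 ≤ Delta1r 0 s / DeltaXir n 0 s := by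
    rw [le_div_iff₀ hD]
    have := DeltaXir_le_Delta1r n s hs
    have hpi := Real.pi_pos
    have h4 : 4 / Real.pi ^ 2 * DeltaXir n 0 s ≤ 4 / Real.pi ^ 2 * (Real.pi ^ 2 / 4 * Delta1r 0 s) :=
      mul_le_mul_of_nonneg_left this (by positivity)
    calc 4 / Real.pi ^ 2 * DeltaXir n 0 s ≤ 4 / Real.pi ^ 2 * (Real.pi ^ 2 / 4 * Delta1r 0 s) := h4
      _ = Delta1r 0 s := by field_simp
  have h12 : (4 / Real.pi ^ 2) ^ d * (4 / Real.pi ^ 2)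
      ≤ Ur n (fun _ => (0 : Fin n)) s * uFactorr n ((fun _ => (0 : Fin n)) μ : ℕ) (s μ) :=
    mul_le_mul h1 h2 (by positivity) (Ur_nonneg _ _ _)
  have h123 : (4 / Real.pi ^ 2) ^ d * (4 / Real.pi ^ 2) * (4 / Real.pi ^ 2)
      ≤ Ur n (fun _ => (0 : Fin n)) s * uFactorr n ((fun _ => (0 : Fin n)) μ : ℕ) (s μ)
          * (Delta1r 0 s / DeltaXir n 0 s) :=
    mul_le_mul h12 h3 (by positivity) (mul_nonneg (Ur_nonneg _ _ _) (uFactorr_nonneg _ _ _))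
  -- the `l″ = 0` term of the sum
  set f : (Fin d → Fin n) → ℝ := fun k => Ur n k s * uFactorr n (k μ : ℕ) (s μ) / DeltaXir n 0 (shiftr n k s) with hf
  have hsum : f (fun _ => 0) ≤ ∑ k, f k :=
    Finset.single_le_sum (fun k _ => phiMu_term_nonneg n μ s k) (Finset.mem_univ _)
  have hf0 : f (fun _ => 0) * Delta1r 0 s
      = Ur n (fun _ => (0 : Fin n)) s * uFactorr n ((fun _ => (0 : Fin n)) μ : ℕ) (s μ)
          * (Delta1r 0 s / DeltaXir n 0 s) := by
    rw [hf]; simp only [shiftr_zero]; ring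
  have hmain : Delta1r 0 s * phiMu n a μ s = Delta1r 0 s + a * ((∑ k, f k) * Delta1r 0 s) := by
    unfold phiMu; rw [hf]; ring
  rw [hmain]
  have h5 : a * (f (fun _ => 0) * Delta1r 0 s) ≤ a * ((∑ k, f k) * Delta1r 0 s) :=
    mul_le_mul_of_nonneg_left (mul_le_mul_of_nonneg_right hsum hΔ0) ha
  have h6 : a * ((4 / Real.pi ^ 2) ^ d * (4 / Real.pi ^ 2) * (4 / Real.pi ^ 2))
      ≤ a * (f (fun _ => 0) * Delta1r 0 s) := by
    rw [hf0]; exact mul_le_mul_of_nonneg_left h123 ha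
  calc a * (4 / Real.pi ^ 2) ^ (d + 2) = a * ((4 / Real.pi ^ 2) ^ d * (4 / Real.pi ^ 2) * (4 / Real.pi ^ 2)) := by ring
    _ ≤ a * (f (fun _ => 0) * Delta1r 0 s) := h6
    _ ≤ Delta1r 0 s + a * ((∑ k, f k) * Delta1r 0 s) := by linarith

/-- (1.85), UPPER BOUND (census §2: `Δ₀φ_μ ≤ Δ₀ + a·1 + a Σ_{l″≠0} |u(p′+l″)|² Δ₀/4 ≤ 4d + a + a d S₀` by E1–E3),
with the `l″ ≠ 0` mass `S₀ ≥ Σ_{l″≠0} |u(p′+l″)|²` as the one hypothesis (E4 of the census gives `S₀ = 1 − |u(p′)|² ≤ 1`);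
valid on the whole Brillouin zone, every `n ≥ 1`, `a ≥ 0`. [cite: Balaban1984PropagatorsI, (1.85) p.32] -/
theorem ineq185_upper (n : ℕ) [NeZero n] (hn : 1 ≤ n) (a : ℝ) (ha : 0 ≤ a) (μ : Fin d) (s : Fin d → ℝ)
    (hs : ∀ ν, |s ν| ≤ Real.pi) (S0 : ℝ)
    (hS0 : ∑ k ∈ (Finset.univ.erase (fun _ => (0 : Fin n))), Ur n k s ≤ S0) :
    Delta1r 0 s * phiMu n a μ s ≤ 4 * d + a + a * d * S0 := by
  have hΔ0 : 0 ≤ Delta1r 0 s := Delta1r_nonneg 0 le_rfl s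
  have hΔ4 : Delta1r 0 s ≤ 4 * d := Delta1r_le s
  set f : (Fin d → Fin n) → ℝ := fun k => Ur n k s * uFactorr n (k μ : ℕ) (s μ) / DeltaXir n 0 (shiftr n k s) with hf
  have hmain : Delta1r 0 s * phiMu n a μ s = Delta1r 0 s + a * ∑ k, f k * Delta1r 0 s := by
    unfold phiMu; rw [hf]; beta_reduce; rw [← Finset.sum_mul]; ring
  rw [hmain, ← Finset.add_sum_erase _ _ (Finset.mem_univ (fun _ => (0 : Fin n)))]
  -- the `l″ = 0` term is ≤ 1
  have h0 : f (fun _ => 0) * Delta1r 0 s ≤ 1 := by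
    rw [hf]; simp only [shiftr_zero]
    have hU := Ur_le_one n hn (fun _ => (0 : Fin n)) s
    have hv := uFactorr_le_one n hn ((fun _ => (0 : Fin n)) μ : ℕ) (s μ)
    have hr : Delta1r 0 s / DeltaXir n 0 s ≤ 1 := by
      rcases (DeltaXir_nonneg n 0 le_rfl s).eq_or_lt with h | hpos
      · rw [← h, div_zero]; exact zero_le_one
      · rw [div_le_iff₀ hpos, one_mul]; exact Delta1r_le_DeltaXir n hn s
    have hr0 : 0 ≤ Delta1r 0 s / DeltaXir n 0 s := div_nonneg hΔ0 (DeltaXir_nonneg n 0 le_rfl s)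
    calc Ur n (fun _ => (0 : Fin n)) s * uFactorr n ((fun _ => (0 : Fin n)) μ : ℕ) (s μ) / DeltaXir n 0 s * Delta1r 0 s
        = (Ur n (fun _ => (0 : Fin n)) s * uFactorr n ((fun _ => (0 : Fin n)) μ : ℕ) (s μ))
            * (Delta1r 0 s / DeltaXir n 0 s) := by ring
      _ ≤ (1 * 1) * 1 := by
          apply mul_le_mul (mul_le_mul hU hv (uFactorr_nonneg _ _ _) zero_le_one) hr hr0 (by positivity)
      _ = 1 := by ring
  -- each `l″ ≠ 0` term is ≤ d · |u(p′+l″)|²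
  have hrest : ∑ k ∈ (Finset.univ.erase (fun _ => (0 : Fin n))), f k * Delta1r 0 s
      ≤ ∑ k ∈ (Finset.univ.erase (fun _ => (0 : Fin n))), (d : ℝ) * Ur n k s := by
    apply Finset.sum_le_sum
    intro k hk
    have hk0 : k ≠ fun _ => 0 := Finset.ne_of_mem_erase hk
    have hD4 := DeltaXir_shift_ge_four n k hk0 s hs
    have hDpos : 0 < DeltaXir n 0 (shiftr n k s) := by linarith
    have hv := uFactorr_le_one n hn (k μ : ℕ) (s μ)
    have hU0 := Ur_nonneg n k s
    rw [hf]
    simp only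
    rw [div_mul_eq_mul_div, div_le_iff₀ hDpos]
    have h7 : Ur n k s * uFactorr n (k μ : ℕ) (s μ) ≤ Ur n k s * 1 := mul_le_mul_of_nonneg_left hv hU0
    have h8 : (d : ℝ) * Ur n k s * 4 ≤ (d : ℝ) * Ur n k s * DeltaXir n 0 (shiftr n k s) :=
      mul_le_mul_of_nonneg_left hD4 (by positivity)
    nlinarith [mul_nonneg (mul_nonneg hU0 (uFactorr_nonneg n (k μ : ℕ) (s μ))) hΔ0]
  have hrest' : ∑ k ∈ (Finset.univ.erase (fun _ => (0 : Fin n))), (d : ℝ) * Ur n k s ≤ d * S0 := by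
    rw [← Finset.mul_sum]; exact mul_le_mul_of_nonneg_left hS0 (by positivity)
  nlinarith

/-- (1.86) "has the same property, hence also its inverse": from `0 < γ₋ ≤ Δ₀(p′)φ_λ(p′) ≤ γ₊` for every `λ` it follows that
`γ₊⁻¹ ≤ Σ_λ |∂_{1,λ}(p′)|²/(Δ₀²(p′)φ_λ(p′)) ≤ γ₋⁻¹` on the punctured zone (a convex combination of the `(Δ₀φ_λ)⁻¹`
with weights `|∂_{1,λ}|²/Δ₀`). [cite: Balaban1984PropagatorsI, (1.86) p.32] -/
theorem ineq186 (n : ℕ) [NeZero n] (a γm γp : ℝ) (hγm : 0 < γm) (s : Fin d → ℝ)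
    (hs : ∀ ν, |s ν| ≤ Real.pi) (ν₀ : Fin d) (hν₀ : s ν₀ ≠ 0)
    (hlo : ∀ μ, γm ≤ Delta1r 0 s * phiMu n a μ s) (hhi : ∀ μ, Delta1r 0 s * phiMu n a μ s ≤ γp) :
    1 / γp ≤ q186 n a s ∧ q186 n a s ≤ 1 / γm := by
  have hΔpos : 0 < Delta1r 0 s := Delta1r_pos s hs ν₀ hν₀
  have hsumS : ∑ μ : Fin d, S1r (s μ) = Delta1r 0 s := by unfold Delta1r; simp
  have hterm : ∀ μ, S1r (s μ) / (Delta1r 0 s ^ 2 * phiMu n a μ s)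
      = (S1r (s μ) / Delta1r 0 s) * (1 / (Delta1r 0 s * phiMu n a μ s)) := by
    intro μ
    rw [div_mul_div_comm, mul_one, sq, mul_assoc]
  have hw : ∀ μ, 0 ≤ S1r (s μ) / Delta1r 0 s := fun μ => div_nonneg (S1r_nonneg _) hΔpos.le
  have hwsum : ∑ μ : Fin d, S1r (s μ) / Delta1r 0 s = 1 := by
    rw [← Finset.sum_div, hsumS, div_self hΔpos.ne']
  constructor
  · unfold q186
    calc 1 / γp = ∑ μ : Fin d, (S1r (s μ) / Delta1r 0 s) * (1 / γp) := by rw [← Finset.sum_mul, hwsum, one_mul]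
      _ ≤ ∑ μ : Fin d, (S1r (s μ) / Delta1r 0 s) * (1 / (Delta1r 0 s * phiMu n a μ s)) := by
          apply Finset.sum_le_sum; intro μ _
          apply mul_le_mul_of_nonneg_left _ (hw μ)
          exact one_div_le_one_div_of_le (lt_of_lt_of_le hγm (hlo μ)) (hhi μ)
      _ = ∑ μ : Fin d, S1r (s μ) / (Delta1r 0 s ^ 2 * phiMu n a μ s) := by
          apply Finset.sum_congr rfl; intro μ _; rw [hterm]
  · unfold q186
    calc ∑ μ : Fin d, S1r (s μ) / (Delta1r 0 s ^ 2 * phiMu n a μ s)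
        = ∑ μ : Fin d, (S1r (s μ) / Delta1r 0 s) * (1 / (Delta1r 0 s * phiMu n a μ s)) := by
          apply Finset.sum_congr rfl; intro μ _; rw [hterm]
      _ ≤ ∑ μ : Fin d, (S1r (s μ) / Delta1r 0 s) * (1 / γm) := by
          apply Finset.sum_le_sum; intro μ _
          apply mul_le_mul_of_nonneg_left _ (hw μ)
          exact one_div_le_one_div_of_le hγm (hlo μ)
      _ = 1 / γm := by rw [← Finset.sum_mul, hwsum, one_mul]

/-- (1.85)–(1.86) TOGETHER with the census constants: on the punctured Brillouin zone, for `n = L^k ≥ 1`, `a > 0` and any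
`S₀` dominating `Σ_{l″≠0}|u(p′+l″)|²`,  `γ₋ := a(4/π²)^{d+2} ≤ Δ₀φ_μ ≤ γ₊ := 4d + a + a d S₀` and
`γ₊⁻¹ ≤ (1.86) ≤ γ₋⁻¹` — constants "independent of `k` and depending on `d` and `a` only" (and on the leaf `S₀`, `= 1` by E4).
[cite: Balaban1984PropagatorsI, (1.85)–(1.86) p.32] -/
theorem ineq186_explicit (n : ℕ) [NeZero n] (hn : 1 ≤ n) (a : ℝ) (ha : 0 < a) (s : Fin d → ℝ)
    (hs : ∀ ν, |s ν| ≤ Real.pi) (ν₀ : Fin d) (hν₀ : s ν₀ ≠ 0) (S0 : ℝ)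
    (hS0 : ∑ k ∈ (Finset.univ.erase (fun _ => (0 : Fin n))), Ur n k s ≤ S0) :
    (∀ μ, a * (4 / Real.pi ^ 2) ^ (d + 2) ≤ Delta1r 0 s * phiMu n a μ s
        ∧ Delta1r 0 s * phiMu n a μ s ≤ 4 * d + a + a * d * S0)
    ∧ 1 / (4 * d + a + a * d * S0) ≤ q186 n a s ∧ q186 n a s ≤ 1 / (a * (4 / Real.pi ^ 2) ^ (d + 2)) := by
  have hlo := fun μ => ineq185_lower n hn a ha.le μ s hs ν₀ hν₀
  have hhi := fun μ => ineq185_upper n hn a ha.le μ s hs S0 hS0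
  have hγm : 0 < a * (4 / Real.pi ^ 2) ^ (d + 2) := by have := Real.pi_pos; positivity
  exact ⟨fun μ => ⟨hlo μ, hhi μ⟩, ineq186 n a _ _ hγm s hs ν₀ hν₀ hlo hhi⟩

/-! ### E4 (kernel): `Σ_l |u(p′+l)|² = 1` via the Fejér mass identity and roots of unity

The census leaf E4 — "`Σ_l |u(l)|² = Π_μ Σ_{m̃_μ} |v_μ|² = 1` (the classical identity `Σ_{m mod N} csc²(x + mπ/N) =
N² csc²(Nx)`)" — is proved here from scratch: `|v_μ|²(x; j) = n⁻²|Σ_{r<n} e^{ir(x+2πj)/n}|²` (a Dirichlet-kernel modulus),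
and `Σ_{j<n} |Σ_{r<n} e^{irθ_j}|² = Σ_{r,r′} e^{i(r′−r)x/n} Σ_j e^{2πi(r′−r)j/n} = n·n` by orthogonality of characters.
With it the hypothesis `S₀` of `ineq185_upper` is discharged (`S0_le_one`) and (1.85)–(1.86) hold with the constants
`γ₋ = a(4/π²)^{d+2}`, `γ₊ = 4d + a + a·d` (`ineq185_186`). -/

section E4
open Complex

/-- `|e^{it} − 1|² = 2 − 2 cos t = S₁(t)`. [folklore] -/
theorem normSq_exp_sub_one (t : ℝ) : Complex.normSq (Complex.exp (t * I) - 1) = S1r t := by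
  rw [Complex.normSq_apply, Complex.sub_re, Complex.sub_im, Complex.exp_ofReal_mul_I_re,
    Complex.exp_ofReal_mul_I_im, Complex.one_re, Complex.one_im]
  unfold S1r
  nlinarith [Real.sin_sq_add_cos_sq t]

/-- `e^{it} ≠ 1 ⟺ S₁(t) ≠ 0`. [folklore] -/
theorem exp_ne_one_of_S1r_ne (t : ℝ) : Complex.exp (t * I) ≠ 1 ↔ S1r t ≠ 0 := by
  rw [← normSq_exp_sub_one, Ne, Ne, Complex.normSq_eq_zero, sub_eq_zero]

/-- Fejér / Dirichlet kernel: `|Σ_{r<n} e^{irt}|² · S₁(t) = S₁(nt)` when `e^{it} ≠ 1`. [folklore] -/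
theorem normSq_geom_sum_mul (t : ℝ) (n : ℕ) (h : Complex.exp (t * I) ≠ 1) :
    Complex.normSq (∑ r ∈ range n, Complex.exp (t * I) ^ r) * S1r t = S1r (n * t) := by
  rw [geom_sum_eq h n, map_div₀, ← Complex.exp_nat_mul,
      show (n : ℂ) * (t * I) = ((n * t : ℝ) : ℂ) * I by push_cast; ring,
      normSq_exp_sub_one, normSq_exp_sub_one]
  have h0 : S1r t ≠ 0 := (exp_ne_one_of_S1r_ne t).mp h
  field_simp

/-- roots of unity: `Σ_{j<n} e^{2πi m j/n} = 0` when `n ∤ m`. [folklore] -/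
theorem sum_rootOfUnity_pow (n : ℕ) (hn : 1 ≤ n) (m : ℤ) (hm : ¬ (n : ℤ) ∣ m) :
    ∑ j ∈ range n, Complex.exp (2 * Real.pi * I * m * j / n) = 0 := by
  have hn0 : (n : ℂ) ≠ 0 := by exact_mod_cast (show n ≠ 0 by omega)
  set ζ := Complex.exp (2 * Real.pi * I * m / n) with hζ
  have hterm : ∀ j : ℕ, Complex.exp (2 * Real.pi * I * m * j / n) = ζ ^ j := by
    intro j; rw [hζ, ← Complex.exp_nat_mul]; congr 1; field_simp
  simp_rw [hterm]
  have hζ1 : ζ ≠ 1 := by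
    rw [hζ]; intro h
    obtain ⟨q, hq⟩ := Complex.exp_eq_one_iff.mp h
    rw [div_eq_iff hn0] at hq
    have h2 : (2 * Real.pi * I : ℂ) * ((m : ℂ) - q * n) = 0 := by linear_combination hq
    have hπ : (2 * Real.pi * I : ℂ) ≠ 0 := by
      have : (Real.pi : ℂ) ≠ 0 := by exact_mod_cast Real.pi_ne_zero
      simp [this, Complex.I_ne_zero]
    have h3 : (m : ℂ) = q * n := by
      have := (mul_eq_zero.mp h2).resolve_left hπ
      exact sub_eq_zero.mp this
    apply hm
    refine ⟨q, ?_⟩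
    have h4 : (m : ℂ) = ((n * q : ℤ) : ℂ) := by rw [h3]; push_cast; ring
    exact_mod_cast h4
  have hζn : ζ ^ n = 1 := by
    rw [hζ, ← Complex.exp_nat_mul,
      show (n : ℂ) * (2 * Real.pi * I * m / n) = m * (2 * Real.pi * I) by field_simp]
    exact Complex.exp_int_mul_two_pi_mul_I m
  rw [geom_sum_eq hζ1, hζn, sub_self, zero_div]

/-- orthogonality of the characters of `ℤ/n` restricted to `0 ≤ r, r′ < n`. [folklore] -/
theorem sum_char (n : ℕ) (hn : 1 ≤ n) (r r' : ℕ) (hr : r < n) (hr' : r' < n) :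
    ∑ j ∈ range n, Complex.exp (2 * Real.pi * I * ((r' : ℂ) - r) * j / n)
      = if r = r' then (n : ℂ) else 0 := by
  split_ifs with h
  · subst h; simp
  · have hm : ¬ (n : ℤ) ∣ ((r' : ℤ) - r) := by
      intro hd
      have hlt : |((r' : ℤ) - r)| < n := by
        rw [abs_sub_lt_iff]; constructor <;> omega
      have := Int.eq_zero_of_abs_lt_dvd hd hlt
      omega
    have := sum_rootOfUnity_pow n hn ((r' : ℤ) - r) hm
    push_cast at this
    exact this

/-- bookkeeping: the `j`-independent phase `e^{i(x/n)(r′−r)}`. [folklore] -/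
def Afun (n : ℕ) (x : ℝ) (r r' : ℕ) : ℂ := Complex.exp ((x / n : ℝ) * I * ((r' : ℂ) - r))
/-- bookkeeping: the character `e^{2πi(r′−r)j/n}`. [folklore] -/
def Bfun (n : ℕ) (r r' j : ℕ) : ℂ := Complex.exp (2 * Real.pi * I * ((r' : ℂ) - r) * j / n)

/-- `Σ_j Bfun = n·[r = r′]`. [folklore] -/
theorem sum_Bfun (n : ℕ) (hn : 1 ≤ n) (r r' : ℕ) (hr : r < n) (hr' : r' < n) :
    ∑ j ∈ range n, Bfun n r r' j = if r = r' then (n : ℂ) else 0 := by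
  unfold Bfun; exact sum_char n hn r r' hr hr'

/-- `Afun r r = 1`. [folklore] -/
theorem Afun_self (n : ℕ) (x : ℝ) (r : ℕ) : Afun n x r r = 1 := by simp [Afun]

/-- the Fejér mass identity `Σ_{j<n} |Σ_{r<n} e^{i r (x+2πj)/n}|² = n²` (expand the squares, exchange the sums, orthogonality). [folklore] -/
theorem sum_normSq_geom_sum (n : ℕ) (hn : 1 ≤ n) (x : ℝ) :
    ∑ j ∈ range n, Complex.normSq (∑ r ∈ range n, Complex.exp ((((x + 2 * Real.pi * j) / n : ℝ) : ℂ) * I) ^ r)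
      = (n : ℝ) ^ 2 := by
  have hn0 : (n : ℂ) ≠ 0 := by exact_mod_cast (show n ≠ 0 by omega)
  have key : ∀ j : ℕ, ((Complex.normSq (∑ r ∈ range n,
      Complex.exp ((((x + 2 * Real.pi * j) / n : ℝ) : ℂ) * I) ^ r) : ℝ) : ℂ)
      = ∑ r ∈ range n, ∑ r' ∈ range n, Afun n x r r' * Bfun n r r' j := by
    intro j
    simp only [Afun, Bfun]
    rw [Complex.normSq_eq_conj_mul_self, map_sum, Finset.sum_mul_sum]
    apply Finset.sum_congr rfl; intro r _
    apply Finset.sum_congr rfl; intro r' _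
    rw [map_pow, ← Complex.exp_conj, ← Complex.exp_nat_mul, ← Complex.exp_nat_mul, ← Complex.exp_add,
      ← Complex.exp_add]
    congr 1
    simp only [map_mul, Complex.conj_ofReal, Complex.conj_I]
    push_cast
    field_simp
    ring
  have hsum : ((∑ j ∈ range n, Complex.normSq (∑ r ∈ range n,
      Complex.exp ((((x + 2 * Real.pi * j) / n : ℝ) : ℂ) * I) ^ r) : ℝ) : ℂ) = (n : ℂ) ^ 2 := by
    rw [Complex.ofReal_sum]
    simp_rw [key]
    calc ∑ j ∈ range n, ∑ r ∈ range n, ∑ r' ∈ range n, Afun n x r r' * Bfun n r r' j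
        = ∑ r ∈ range n, ∑ r' ∈ range n, Afun n x r r' * ∑ j ∈ range n, Bfun n r r' j := by
          rw [Finset.sum_comm]
          apply Finset.sum_congr rfl; intro r _
          rw [Finset.sum_comm]
          apply Finset.sum_congr rfl; intro r' _
          rw [Finset.mul_sum]
      _ = ∑ r ∈ range n, ∑ r' ∈ range n, Afun n x r r' * (if r = r' then (n : ℂ) else 0) := by
          apply Finset.sum_congr rfl; intro r hr
          apply Finset.sum_congr rfl; intro r' hr'
          rw [sum_Bfun n hn r r' (mem_range.mp hr) (mem_range.mp hr')]
      _ = ∑ r ∈ range n, (n : ℂ) := by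
          apply Finset.sum_congr rfl; intro r hr
          simp only [mul_ite, mul_zero, Finset.sum_ite_eq, hr, if_true, Afun_self, one_mul]
      _ = (n : ℂ) ^ 2 := by simp [sq]
  exact_mod_cast hsum

/-- one factor of `|u|²` as a Fejér mass: for `0 < |x| ≤ π` and every `j`,
`|v_μ|²(x; j) = S₁(x)/S_ξ(x + 2πj) = n⁻² |Σ_{r<n} e^{i r (x+2πj)/n}|²` (`S_ξ(y) = n² S₁(y/n)`, `S₁(x) = S₁(x + 2πj) = S₁(n·t)`,
`t = (x+2πj)/n`, and `e^{it} ≠ 1` because `x ∉ 2πℤ`). [folklore] -/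
theorem uFactorr_eq_normSq (n : ℕ) (hn : 1 ≤ n) (j : ℕ) (x : ℝ) (hx0 : x ≠ 0) (hx : |x| ≤ Real.pi) :
    uFactorr n j x = Complex.normSq (∑ r ∈ range n,
      Complex.exp ((((x + 2 * Real.pi * j) / n : ℝ) : ℂ) * I) ^ r) / (n : ℝ) ^ 2 := by
  have hn0 : (n : ℝ) ≠ 0 := by exact_mod_cast (show n ≠ 0 by omega)
  have hpi := Real.pi_pos
  set t : ℝ := (x + 2 * Real.pi * j) / n with ht
  -- uFactorr n j x = S1r x / Sxir n (x + 2π j) in both branches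
  have h1 : uFactorr n j x = S1r x / Sxir n (x + 2 * Real.pi * j) := by
    unfold uFactorr
    by_cases hj : j = 0
    · subst hj; simp [hx0]
    · simp [hj]
  have h2 : Sxir n (x + 2 * Real.pi * j) = (n : ℝ) ^ 2 * S1r t := by
    rw [ht]; unfold Sxir S1r; rfl
  have h3 : S1r x = S1r (n * t) := by
    rw [ht]; unfold S1r
    rw [mul_div_cancel₀ _ hn0, show x + 2 * Real.pi * j = x + j * (2 * Real.pi) by ring,
      Real.cos_add_nat_mul_two_pi]
  -- e^{it} ≠ 1 because x ∉ 2πℤ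
  have h4 : Complex.exp (t * I) ≠ 1 := by
    intro h
    obtain ⟨q, hq⟩ := Complex.exp_eq_one_iff.mp h
    have hq' : (t : ℂ) = ((2 * Real.pi * q : ℝ) : ℂ) := by
      have hI : (I : ℂ) ≠ 0 := Complex.I_ne_zero
      have := hq
      push_cast
      apply mul_right_cancel₀ hI
      rw [this]; ring
    have hq2 : t = 2 * Real.pi * q := by exact_mod_cast hq'
    -- x = 2π (q n − j)
    have hx2 : x = 2 * Real.pi * ((q * n - j : ℤ) : ℝ) := by
      rw [ht] at hq2
      have := (div_eq_iff hn0).mp hq2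
      push_cast; linarith
    obtain ⟨hxa, hxb⟩ := abs_le.mp hx
    have hz : (q * n - j : ℤ) = 0 := by
      by_contra hne
      rcases lt_or_gt_of_ne hne with hlt | hgt
      · have : ((q * n - j : ℤ) : ℝ) ≤ -1 := by exact_mod_cast Int.le_sub_one_of_lt hlt
        nlinarith
      · have : (1 : ℝ) ≤ ((q * n - j : ℤ) : ℝ) := by exact_mod_cast hgt
        nlinarith
    rw [hz] at hx2; simp at hx2; exact hx0 hx2
  have h5 := normSq_geom_sum_mul t n h4
  have h6 : S1r t ≠ 0 := (exp_ne_one_of_S1r_ne t).mp h4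
  rw [h1, h2, h3, ← h5]
  field_simp

/-- E4 in one variable: `Σ_{j<n} |v_μ|²(x; j) = 1` for `0 < |x| ≤ π` (= the classical
`Σ_{m mod N} csc²(y + mπ/N) = N² csc²(Ny)`, here obtained from the Fejér mass identity). [folklore] -/
theorem sum_uFactorr (n : ℕ) (hn : 1 ≤ n) (x : ℝ) (hx0 : x ≠ 0) (hx : |x| ≤ Real.pi) :
    ∑ j ∈ range n, uFactorr n j x = 1 := by
  have hn0 : (n : ℝ) ≠ 0 := by exact_mod_cast (show n ≠ 0 by omega)
  simp_rw [uFactorr_eq_normSq n hn _ x hx0 hx]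
  rw [← Finset.sum_div, sum_normSq_geom_sum n hn x, div_self (pow_ne_zero 2 hn0)]

/-- E4 in one variable at `x = 0`: the `j = 0` factor is `1` (the removable singularity) and the others vanish. [folklore] -/
theorem sum_uFactorr_zero (n : ℕ) (hn : 1 ≤ n) : ∑ j ∈ range n, uFactorr n j 0 = 1 := by
  have h : ∀ j ∈ range n, uFactorr n j 0 = if j = 0 then 1 else 0 := by
    intro j _
    unfold uFactorr
    by_cases hj : j = 0
    · simp [hj]
    · simp [hj, S1r]
  rw [Finset.sum_congr rfl h, Finset.sum_ite_eq' (range n) 0 (fun _ => (1 : ℝ))]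
  simp [show 0 < n by omega]


/-- E4 in one variable on the whole zone `|x| ≤ π`, indexed by `Fin n`. [folklore] -/
theorem sum_uFactorr_fin (n : ℕ) (hn : 1 ≤ n) (x : ℝ) (hx : |x| ≤ Real.pi) :
    ∑ j : Fin n, uFactorr n (j : ℕ) x = 1 := by
  rw [Fin.sum_univ_eq_sum_range (fun j => uFactorr n j x) n]
  by_cases hx0 : x = 0
  · subst hx0; exact sum_uFactorr_zero n hn
  · exact sum_uFactorr n hn x hx0 hx

/-- E4 (census): `Σ_{l} |u(p′+l)|² = 1` on the Brillouin zone, every `n = L^k ≥ 1` — in operator language `Q_k Q_k* = I`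
read in momentum space. KERNEL (product over directions of `sum_uFactorr_fin`). [folklore] -/
theorem sum_Ur_eq_one (n : ℕ) [NeZero n] (hn : 1 ≤ n) (s : Fin d → ℝ) (hs : ∀ μ, |s μ| ≤ Real.pi) :
    ∑ k : Fin d → Fin n, Ur n k s = 1 := by
  unfold Ur
  have h := Finset.prod_univ_sum (fun _ : Fin d => (Finset.univ : Finset (Fin n)))
    (fun μ (j : Fin n) => uFactorr n (j : ℕ) (s μ))
  rw [Fintype.piFinset_univ] at h
  rw [← h]
  simp only [sum_uFactorr_fin n hn _ (hs _), Finset.prod_const_one]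

/-- hence the `l ≠ 0` mass is `S₀ = 1 − |u(p′)|² ≤ 1 − (4/π²)^d ≤ 1`. [folklore] -/
theorem S0_eq (n : ℕ) [NeZero n] (hn : 1 ≤ n) (s : Fin d → ℝ) (hs : ∀ μ, |s μ| ≤ Real.pi) :
    ∑ k ∈ (Finset.univ.erase (fun _ => (0 : Fin n))), Ur n k s = 1 - Ur n (fun _ => (0 : Fin n)) s := by
  have h := Finset.add_sum_erase Finset.univ (fun k => Ur n k s) (Finset.mem_univ (fun _ => (0 : Fin n)))
  rw [sum_Ur_eq_one n hn s hs] at h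
  linarith

/-- `S₀ ≤ 1`. [folklore] -/
theorem S0_le_one (n : ℕ) [NeZero n] (hn : 1 ≤ n) (s : Fin d → ℝ) (hs : ∀ μ, |s μ| ≤ Real.pi) :
    ∑ k ∈ (Finset.univ.erase (fun _ => (0 : Fin n))), Ur n k s ≤ 1 := by
  rw [S0_eq n hn s hs]
  have := Ur_nonneg n (fun _ => (0 : Fin n)) s
  linarith

/-- (1.85) UPPER BOUND, leaf-free: `Δ₀(p′)φ_μ(p′) ≤ 4d + 2a·… ` precisely `≤ 4d + a + a·d` on the whole Brillouin zone,
every `n = L^k ≥ 1`, `a ≥ 0`. [cite: Balaban1984PropagatorsI, (1.85) p.32] -/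
theorem ineq185_upper' (n : ℕ) [NeZero n] (hn : 1 ≤ n) (a : ℝ) (ha : 0 ≤ a) (μ : Fin d) (s : Fin d → ℝ)
    (hs : ∀ ν, |s ν| ≤ Real.pi) : Delta1r 0 s * phiMu n a μ s ≤ 4 * d + a + a * d := by
  have h := ineq185_upper n hn a ha μ s hs 1 (S0_le_one n hn s hs)
  simpa using h

/-- (1.85)–(1.86) with ALL constants kernel-checked: on the punctured Brillouin zone, for every `n = L^k ≥ 1`, `a > 0`,
`μ`:  `a(4/π²)^{d+2} ≤ Δ₀(p′)φ_μ(p′) ≤ 4d + a + a d`  and  `(4d + a + a d)⁻¹ ≤ (1.86) ≤ (a(4/π²)^{d+2})⁻¹` — the printed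
"bounded from below and above by positve [sic] constants independent of `k` and depending on `d` and `a` only … has the
same property, hence also its inverse", made explicit. [cite: Balaban1984PropagatorsI, (1.85)–(1.86) p.32] -/
theorem ineq185_186 (n : ℕ) [NeZero n] (hn : 1 ≤ n) (a : ℝ) (ha : 0 < a) (s : Fin d → ℝ)
    (hs : ∀ ν, |s ν| ≤ Real.pi) (ν₀ : Fin d) (hν₀ : s ν₀ ≠ 0) :
    (∀ μ, a * (4 / Real.pi ^ 2) ^ (d + 2) ≤ Delta1r 0 s * phiMu n a μ s
        ∧ Delta1r 0 s * phiMu n a μ s ≤ 4 * d + a + a * d)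
    ∧ 1 / (4 * d + a + a * d) ≤ q186 n a s ∧ q186 n a s ≤ 1 / (a * (4 / Real.pi ^ 2) ^ (d + 2)) := by
  have hlo := fun μ => ineq185_lower n hn a ha.le μ s hs ν₀ hν₀
  have hhi := fun μ => ineq185_upper' n hn a ha.le μ s hs
  have hγm : 0 < a * (4 / Real.pi ^ 2) ^ (d + 2) := by have := Real.pi_pos; positivity
  exact ⟨fun μ => ⟨hlo μ, hhi μ⟩, ineq186 n a _ _ hγm s hs ν₀ hν₀ hlo hhi⟩

end E4

end

end Literature.MathematicalPhysics.QuantumFieldTheory.Balaban1983to89.B5Prop11Leaves
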